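import Literature.MathematicalPhysics.QuantumLattice.TrilayerEvenSectorClosedForm
import HarnessLib

/-!
# Reading a mirror-symmetric trilayer from its three sheets: the inverse of the even-sector
# closed form, the «nonbonding = middle sheet» criterion, and the outer–outer hopping as an
# explicit inflation of the reading

Venture CertifiedManyBodySolver, cell `pub/hubbard-downfold` (stage S1 = ROUTER; the n = 3 boxes #35 Hg-1223,
M314 Tl-1223, M307 Bi-2223, M306 Tl-2223 carry per-plane OP / IP one-band objects and an OP–IP `t⊥` row),
seat hubbard-downfold-mod-4 (technique B, band level); namespace
`Summit.Ventures.CertifiedManyBodySolver.Downfold.TrilayerReading`.  Sequel of `EmeryTrilayerMirror` (odd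
sector = outer plane exactly; `det` factorisation) on the READING side.  WHAT THIS IS NOT: a statement
about any material; a claim about which sheet a code labels how; `k_z` dispersion; inequivalent outer
planes; four or more layers; the sign of `t⊥` (only `t²` is readable from energies).

Literature's `TrilayerSplittingIdentities` and `TrilayerEvenSectorClosedForm` solve the FORWARD problem for the
scalar (per-`k`) trilayer `!![εo, s, t; s, εo, t; t, t, εi]` (outer level `εo`, inner level `εi`,
outer–inner hopping `t`, direct outer–outer hopping `s`): nonbonding sheet `E₀ = εo − s` (inner weight
`0`) and even sheets `E_∓ = λ_∓ = (εo + s + εi)/2 ∓ D/2`, `D = √(δ² + 8t²)`, `δ = εi − (εo + s)`.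
Every consumer of a trilayer band structure — the three `CuO₂`-derived one-band sheets of a Wannier /
Kohn–Sham fit of HgBa₂Ca₂Cu₃O₈, TlBa₂Ca₂Cu₃O₉, Bi₂Sr₂Ca₂Cu₃O₁₀, Tl₂Ba₂Ca₂Cu₃O₁₀, or the `d_{3z²−r²}`
triplet of La₄Ni₃O₁₀ [SakakibaraEtAl2024, §III, Table I] — needs the INVERSE problem: given the three
sheet energies at one momentum, what are `(εo, εi, |t|)`?  This file types that reading and what it
costs.  Plane-band (parity) bookkeeping as in [AndersenEtAl1995, §8 Eq. (23)].

* §1 Vieta and INTERLACING for the even pair: `λ_+ λ_− = (εo + s)εi − 2t²`; both diagonal levels of the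
  even block lie between its eigenvalues, `λ_− ≤ εo + s ≤ λ_+` and `λ_− ≤ εi ≤ λ_+` (strictly for
  `t ≠ 0`).
* §2 WHERE THE NONBONDING SHEET SITS: `λ_− ≤ εo − s ≤ λ_+  ↔  s(2s + δ) ≤ t²`
  (`nonbonding_mem_Icc_iff`).  In particular for `s = 0` the pure-outer (zero-inner-weight) sheet is
  ALWAYS the MIDDLE sheet (`nonbonding_mem_Icc_of_s_eq_zero`), and it stays the middle sheet as long
  as `2s² + |s|·|δ| ≤ t²` (`nonbonding_mem_Icc_of_small`) — the identification rule when eigenvector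
  weights are not printed.
* §3 THE READING (inverse map), with the outer–outer hopping `s` DECLARED (three energies cannot fix
  four parameters): `readOuter E₀ s = E₀ + s`, `readInner E₋ E₀ E₊ s = E₊ + E₋ − E₀ − 2s`,
  `readTperpSq E₋ E₀ E₊ s = (E₊ − E₀ − 2s)(E₀ + 2s − E₋)/2`, `readOffset = E₊ + E₋ − 2E₀ − 4s`.
  ROUND TRIP: fed the forward sheets `(λ_−, εo − s, λ_+)` they return `εo`, `εi`, `t²`, `δ` EXACTLY
  (`readOuter_sheets`, `readInner_sheets`, `readTperpSq_sheets`, `readOffset_sheets`); the reading is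
  symmetric in the two even sheets (no bonding/antibonding label is needed, only WHICH sheet is the
  nonbonding one); hence UNIQUENESS of `(εo, εi, t²)` at fixed `s` (`eq_of_sheets_eq`), and conversely
  EXISTENCE: any `E₋ ≤ E₊` with `t² = readTperpSq …` is realised (`levels_of_read`).
* §4 THE PRICE OF NOT KNOWING `s` — explicit, signed: `Δ readOuter = Δs`, `Δ readInner = −2Δs`,
  `readTperpSq(s) = readTperpSq(0) + s(E₊ + E₋ − 2E₀) − 2s²` (`readTperpSq_expand`), so
  `|readTperpSq(s) − readTperpSq(0)| ≤ σ|E₊ + E₋ − 2E₀| + 2σ²` for `|s| ≤ σ` (`abs_readTperpSq_sub_le`):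
  an undeclared outer–outer hopping of size `≤ σ` is carried as an INFLATION of the read `t⊥²`, never
  hidden.  Bounds: `readTperpSq ≥ 0` iff-direction when `E₀ + 2s ∈ [E₋, E₊]`, and
  `readTperpSq ≤ (E₊ − E₋)²/8` always (the splitting floor `D ≥ 2√2|t|` of the companion file, read
  backwards: three sheets can never certify a `|t⊥|` above `(E₊ − E₋)/(2√2)`).
* §5 A rational instance (`εo = s = 0`, `εi = t = 1`: sheets `−1, 0, 2`; read back `0, 1, 1, δ = 1`).

Everything is PROVED (exact algebra); no named facts, no axioms beyond Mathlib's, no `sorry`.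

References: O. K. Andersen, A. I. Liechtenstein, O. Jepsen, F. Paulsen, J. Phys. Chem. Solids 56 (1995)
1573, arXiv:cond-mat/9509044, §8 Eq. (23) (even/odd plane bands of multilayers); H. Sakakibara et al.,
Phys. Rev. B 109 (2024) 144511, arXiv:2309.09462, §III, Table I and caption (inner/outer level offset,
the nonbonding band's vanishing inner component); Z. Luo et al., Phys. Rev. Lett. 131 (2023) 126001,
Eq. (3) (two-level closed form).
-/

noncomputable section

namespace Summit.Ventures.CertifiedManyBodySolver.Downfold.TrilayerReading

open Real Literature.MathematicalPhysics.QuantumLattice Literature.MathematicalPhysics.QuantumLattice.TrilayerEven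

/-! ## §1 Vieta and interlacing for the even pair -/

/-- Vieta, product: `λ_+ · λ_− = (εo + s)·εi − 2t²` (determinant of the even block
`[[εo + s, t], [2t, εi]]`). [cite: LuoEtAl2023, Eq. (3)] -/
theorem levelP_mul_levelM (εo εi t s : ℝ) :
    levelP εo εi t s * levelM εo εi t s = (εo + s) * εi - 2 * t ^ 2 := by
  rw [levelP_def, levelM_def]
  have hD := disc_sq (offset εo εi s) t
  have h : ((εo + s + εi) / 2 + disc (offset εo εi s) t / 2) *
      ((εo + s + εi) / 2 - disc (offset εo εi s) t / 2)
      = ((εo + s + εi) / 2) ^ 2 - disc (offset εo εi s) t ^ 2 / 4 := by ring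
  rw [h, hD, offset_def]
  ring

/-- `εi = εo + s + δ` (the offset, solved for the inner level). [cite: SakakibaraEtAl2024, Table I caption] -/
theorem inner_eq_outerEven_add_offset (εo εi s : ℝ) : εi = εo + s + offset εo εi s := by
  rw [offset_def]; ring

/-- Interlacing, lower/outer: `λ_− ≤ εo + s`. [folklore] -/
theorem levelM_le_outerEven (εo εi t s : ℝ) : levelM εo εi t s ≤ εo + s := by
  have h1 : offset εo εi s ≤ disc (offset εo εi s) t := (le_abs_self _).trans (abs_le_disc _ _)
  have h2 := inner_eq_outerEven_add_offset εo εi s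
  rw [levelM_def]
  linarith

/-- Interlacing, upper/outer: `εo + s ≤ λ_+`. [folklore] -/
theorem outerEven_le_levelP (εo εi t s : ℝ) : εo + s ≤ levelP εo εi t s := by
  have h1 : -offset εo εi s ≤ disc (offset εo εi s) t := (neg_le_abs _).trans (abs_le_disc _ _)
  have h2 := inner_eq_outerEven_add_offset εo εi s
  rw [levelP_def]
  linarith

/-- Interlacing, lower/inner: `λ_− ≤ εi`. [folklore] -/
theorem levelM_le_inner (εo εi t s : ℝ) : levelM εo εi t s ≤ εi := by
  have h1 : -offset εo εi s ≤ disc (offset εo εi s) t := (neg_le_abs _).trans (abs_le_disc _ _)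
  have h2 := inner_eq_outerEven_add_offset εo εi s
  rw [levelM_def]
  linarith

/-- Interlacing, upper/inner: `εi ≤ λ_+`. [folklore] -/
theorem inner_le_levelP (εo εi t s : ℝ) : εi ≤ levelP εo εi t s := by
  have h1 : offset εo εi s ≤ disc (offset εo εi s) t := (le_abs_self _).trans (abs_le_disc _ _)
  have h2 := inner_eq_outerEven_add_offset εo εi s
  rw [levelP_def]
  linarith

/-- `λ_− ≤ λ_+`. [cite: LuoEtAl2023, Eq. (3)] -/
theorem levelM_le_levelP (εo εi t s : ℝ) : levelM εo εi t s ≤ levelP εo εi t s :=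
  (levelM_le_inner εo εi t s).trans (inner_le_levelP εo εi t s)

/-- Strict interlacing for `t ≠ 0`: `λ_− < εo + s < λ_+`. [folklore] -/
theorem outerEven_mem_Ioo {εo εi t s : ℝ} (ht : t ≠ 0) :
    levelM εo εi t s < εo + s ∧ εo + s < levelP εo εi t s := by
  have h0 := abs_lt_disc (δ := offset εo εi s) ht
  have h1 : offset εo εi s < disc (offset εo εi s) t := (le_abs_self _).trans_lt h0
  have h1' : -offset εo εi s < disc (offset εo εi s) t := (neg_le_abs _).trans_lt h0
  have h2 := inner_eq_outerEven_add_offset εo εi s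
  rw [levelM_def, levelP_def]
  constructor <;> linarith

/-- Strict interlacing for `t ≠ 0`: `λ_− < εi < λ_+`. [folklore] -/
theorem inner_mem_Ioo {εo εi t s : ℝ} (ht : t ≠ 0) :
    levelM εo εi t s < εi ∧ εi < levelP εo εi t s := by
  have h0 := abs_lt_disc (δ := offset εo εi s) ht
  have h1 : offset εo εi s < disc (offset εo εi s) t := (le_abs_self _).trans_lt h0
  have h1' : -offset εo εi s < disc (offset εo εi s) t := (neg_le_abs _).trans_lt h0
  have h2 := inner_eq_outerEven_add_offset εo εi s
  rw [levelM_def, levelP_def]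
  constructor <;> linarith

/-! ## §2 Where the nonbonding sheet `εo − s` sits -/

/-- **Nonbonding-sheet position criterion**: the pure-outer sheet `εo − s` lies between the two even
sheets iff `s(2s + δ) ≤ t²`, `δ = εi − (εo + s)`. [folklore] -/
theorem nonbonding_mem_Icc_iff (εo εi t s : ℝ) :
    (levelM εo εi t s ≤ εo - s ∧ εo - s ≤ levelP εo εi t s) ↔
      s * (2 * s + offset εo εi s) ≤ t ^ 2 := by
  have hD0 := disc_nonneg (offset εo εi s) t
  have hD2 := disc_sq (offset εo εi s) t
  have hεi := inner_eq_outerEven_add_offset εo εi s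
  rw [levelM_def, levelP_def]
  constructor
  · rintro ⟨h1, h2⟩
    have a1 : offset εo εi s + 4 * s ≤ disc (offset εo εi s) t := by linarith
    have a2 : -disc (offset εo εi s) t ≤ offset εo εi s + 4 * s := by linarith
    have a4 : (offset εo εi s + 4 * s) ^ 2 ≤ disc (offset εo εi s) t ^ 2 := sq_le_sq' a2 a1
    nlinarith [a4, hD2]
  · intro h
    have a4 : (offset εo εi s + 4 * s) ^ 2 ≤ disc (offset εo εi s) t ^ 2 := by nlinarith [h, hD2]
    have a3 : |offset εo εi s + 4 * s| ≤ disc (offset εo εi s) t := abs_le_of_sq_le_sq a4 hD0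
    obtain ⟨a2, a1⟩ := abs_le.mp a3
    constructor <;> linarith

/-- **For `s = 0` the nonbonding sheet is ALWAYS the middle sheet**: `λ_− ≤ εo ≤ λ_+` — the sheet with
zero inner-plane weight (`TrilayerSplittingIdentities.trilayerScalar_nonbonding_innerWeight`) is
identified from the three energies alone. [cite: AndersenEtAl1995, §8 Eq. (23)] -/
theorem nonbonding_mem_Icc_of_s_eq_zero (εo εi t : ℝ) :
    levelM εo εi t 0 ≤ εo ∧ εo ≤ levelP εo εi t 0 := by
  have h := (nonbonding_mem_Icc_iff εo εi t 0).mpr (by rw [zero_mul]; positivity)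
  rwa [sub_zero] at h

/-- Sufficient condition with `s ≠ 0`: `2s² + |s|·|δ| ≤ t²` keeps the nonbonding sheet in the middle —
a small direct outer–outer hopping does not reorder the sheets. [folklore] -/
theorem nonbonding_mem_Icc_of_small {εo εi t s : ℝ}
    (h : 2 * s ^ 2 + |s| * |offset εo εi s| ≤ t ^ 2) :
    levelM εo εi t s ≤ εo - s ∧ εo - s ≤ levelP εo εi t s := by
  have h1 : s * offset εo εi s ≤ |s| * |offset εo εi s| := by
    rw [← abs_mul]; exact le_abs_self _
  have e : s * (2 * s + offset εo εi s) = 2 * s ^ 2 + s * offset εo εi s := by ring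
  exact (nonbonding_mem_Icc_iff εo εi t s).mpr (by rw [e]; linarith)

/-- For `t ≠ 0` the two even sheets are strictly apart (`λ_− < λ_+`), whatever the offset `δ`.
[cite: LuoEtAl2023, Eq. (3)] -/
theorem levelM_lt_levelP {εo εi t s : ℝ} (ht : t ≠ 0) : levelM εo εi t s < levelP εo εi t s := by
  have h := disc_pos (δ := offset εo εi s) ht
  rw [levelM_def, levelP_def]
  linarith

/-! ## §3 The reading: sheets ↦ parameters, with `s` declared -/

/-- Outer level read from the nonbonding sheet: `εo = E₀ + s`. [folklore] -/
def readOuter (E₀ s : ℝ) : ℝ := E₀ + s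

/-- Inner level read from the three sheets: `εi = E₊ + E₋ − E₀ − 2s` (trace of the even block minus the
outer-even level). [folklore] -/
def readInner (Em E₀ Ep s : ℝ) : ℝ := Ep + Em - E₀ - 2 * s

/-- Squared outer–inner hopping read from the three sheets:
`t² = (E₊ − E₀ − 2s)(E₀ + 2s − E₋)/2`. [folklore] -/
def readTperpSq (Em E₀ Ep s : ℝ) : ℝ := (Ep - E₀ - 2 * s) * (E₀ + 2 * s - Em) / 2

/-- Inner-minus-outer-even offset read from the three sheets: `δ = E₊ + E₋ − 2E₀ − 4s`.
[cite: SakakibaraEtAl2024, Table I caption] -/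
def readOffset (Em E₀ Ep s : ℝ) : ℝ := Ep + Em - 2 * E₀ - 4 * s

/-- Unfolding. [folklore] -/
theorem readOuter_def (E₀ s : ℝ) : readOuter E₀ s = E₀ + s := rfl

/-- Unfolding. [folklore] -/
theorem readInner_def (Em E₀ Ep s : ℝ) : readInner Em E₀ Ep s = Ep + Em - E₀ - 2 * s := rfl

/-- Unfolding. [folklore] -/
theorem readTperpSq_def (Em E₀ Ep s : ℝ) :
    readTperpSq Em E₀ Ep s = (Ep - E₀ - 2 * s) * (E₀ + 2 * s - Em) / 2 := rfl

/-- Unfolding. [cite: SakakibaraEtAl2024, Table I caption] -/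
theorem readOffset_def (Em E₀ Ep s : ℝ) : readOffset Em E₀ Ep s = Ep + Em - 2 * E₀ - 4 * s := rfl

/-- The read offset is the offset of the read levels: `readOffset = readInner − (readOuter + s)`.
[cite: SakakibaraEtAl2024, Table I caption] -/
theorem readOffset_eq (Em E₀ Ep s : ℝ) :
    readOffset Em E₀ Ep s = offset (readOuter E₀ s) (readInner Em E₀ Ep s) s := by
  rw [readOffset_def, offset_def, readOuter_def, readInner_def]; ring

/-- ROUND TRIP, outer: the nonbonding sheet `εo − s` reads back `εo`. [folklore] -/
theorem readOuter_sheets (εo s : ℝ) : readOuter (εo - s) s = εo := by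
  rw [readOuter_def]; ring

/-- ROUND TRIP, inner: the forward sheets `(λ_−, εo − s, λ_+)` read back `εi`. [folklore] -/
theorem readInner_sheets (εo εi t s : ℝ) :
    readInner (levelM εo εi t s) (εo - s) (levelP εo εi t s) s = εi := by
  have h := levelP_add_levelM εo εi t s
  rw [readInner_def]
  linarith

/-- ROUND TRIP, hopping: the forward sheets read back `t²` EXACTLY. [folklore] -/
theorem readTperpSq_sheets (εo εi t s : ℝ) :
    readTperpSq (levelM εo εi t s) (εo - s) (levelP εo εi t s) s = t ^ 2 := by
  have hs := levelP_add_levelM εo εi t s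
  have hp := levelP_mul_levelM εo εi t s
  rw [readTperpSq_def]
  linear_combination ((εo + s) / 2) * hs - (1 / 2) * hp

/-- ROUND TRIP, offset: the forward sheets read back `δ`. [cite: SakakibaraEtAl2024, Table I caption] -/
theorem readOffset_sheets (εo εi t s : ℝ) :
    readOffset (levelM εo εi t s) (εo - s) (levelP εo εi t s) s = offset εo εi s := by
  have h := levelP_add_levelM εo εi t s
  rw [readOffset_def, offset_def]
  linarith

/-- The reading is symmetric in the two even sheets: no bonding/antibonding label is needed.
[folklore] -/
theorem readInner_swap (Em E₀ Ep s : ℝ) : readInner Ep E₀ Em s = readInner Em E₀ Ep s := by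
  rw [readInner_def, readInner_def]; ring

/-- The hopping reading is symmetric in the two even sheets. [folklore] -/
theorem readTperpSq_swap (Em E₀ Ep s : ℝ) : readTperpSq Ep E₀ Em s = readTperpSq Em E₀ Ep s := by
  rw [readTperpSq_def, readTperpSq_def]; ring

/-- The offset reading is symmetric in the two even sheets. [folklore] -/
theorem readOffset_swap (Em E₀ Ep s : ℝ) : readOffset Ep E₀ Em s = readOffset Em E₀ Ep s := by
  rw [readOffset_def, readOffset_def]; ring

/-- **UNIQUENESS at declared `s`**: two scalar trilayers with the same outer–outer hopping `s` and the
same three labelled sheets have the same `εo`, `εi` and `t²`. [folklore] -/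
theorem eq_of_sheets_eq {εo εi t εo' εi' t' s : ℝ} (h0 : εo' - s = εo - s)
    (hM : levelM εo' εi' t' s = levelM εo εi t s) (hP : levelP εo' εi' t' s = levelP εo εi t s) :
    εo' = εo ∧ εi' = εi ∧ t' ^ 2 = t ^ 2 := by
  refine ⟨by linarith, ?_, ?_⟩
  · rw [← readInner_sheets εo' εi' t' s, h0, hM, hP, readInner_sheets]
  · rw [← readTperpSq_sheets εo' εi' t' s, h0, hM, hP, readTperpSq_sheets]

/-- **EXISTENCE**: any two even sheets `E₋ ≤ E₊` together with a nonbonding sheet `E₀` and a declared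
`s` are REALISED by the scalar trilayer with the read parameters — its closed-form even levels are
`E₊` and `E₋` again (for any `t` with `t² = readTperpSq …`). [folklore] -/
theorem levels_of_read {Em E₀ Ep s t : ℝ} (hle : Em ≤ Ep) (ht : t ^ 2 = readTperpSq Em E₀ Ep s) :
    levelP (readOuter E₀ s) (readInner Em E₀ Ep s) t s = Ep ∧
      levelM (readOuter E₀ s) (readInner Em E₀ Ep s) t s = Em := by
  have hδ : offset (readOuter E₀ s) (readInner Em E₀ Ep s) s = Ep + Em - 2 * E₀ - 4 * s := by
    rw [offset_def, readOuter_def, readInner_def]; ring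
  have hrad : (Ep + Em - 2 * E₀ - 4 * s) ^ 2 + 8 * t ^ 2 = (Ep - Em) ^ 2 := by
    rw [ht, readTperpSq_def]; ring
  have hD : disc (offset (readOuter E₀ s) (readInner Em E₀ Ep s) s) t = Ep - Em := by
    rw [disc_def, hδ, hrad]
    exact sqrt_sq (by linarith)
  rw [levelP_def, levelM_def, hD, readOuter_def, readInner_def]
  constructor <;> ring

/-! ## §4 The outer–outer hopping as an explicit inflation of the reading -/

/-- `Δ readOuter = Δs`. [folklore] -/
theorem readOuter_sub (E₀ s s' : ℝ) : readOuter E₀ s - readOuter E₀ s' = s - s' := by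
  rw [readOuter_def, readOuter_def]; ring

/-- `Δ readInner = −2Δs`. [folklore] -/
theorem readInner_sub (Em E₀ Ep s s' : ℝ) :
    readInner Em E₀ Ep s - readInner Em E₀ Ep s' = -(2 * (s - s')) := by
  rw [readInner_def, readInner_def]; ring

/-- `Δ readOffset = −4Δs`. [folklore] -/
theorem readOffset_sub (Em E₀ Ep s s' : ℝ) :
    readOffset Em E₀ Ep s - readOffset Em E₀ Ep s' = -(4 * (s - s')) := by
  rw [readOffset_def, readOffset_def]; ring

/-- **The `s`-dependence of the read `t²`, exactly**:
`readTperpSq(s) = readTperpSq(0) + s(E₊ + E₋ − 2E₀) − 2s²`. [folklore] -/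
theorem readTperpSq_expand (Em E₀ Ep s : ℝ) :
    readTperpSq Em E₀ Ep s = readTperpSq Em E₀ Ep 0 + s * (Ep + Em - 2 * E₀) - 2 * s ^ 2 := by
  rw [readTperpSq_def, readTperpSq_def]; ring

/-- **Inflation bound**: an undeclared outer–outer hopping of size `|s| ≤ σ` moves the read `t²` by at
most `σ·|E₊ + E₋ − 2E₀| + 2σ²`. [folklore] -/
theorem abs_readTperpSq_sub_le {Em E₀ Ep s σ : ℝ} (hs : |s| ≤ σ) :
    |readTperpSq Em E₀ Ep s - readTperpSq Em E₀ Ep 0| ≤ σ * |Ep + Em - 2 * E₀| + 2 * σ ^ 2 := by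
  have e : readTperpSq Em E₀ Ep s - readTperpSq Em E₀ Ep 0
      = s * (Ep + Em - 2 * E₀) - 2 * s ^ 2 := by
    rw [readTperpSq_expand Em E₀ Ep s]; ring
  rw [e]
  have hA : |s * (Ep + Em - 2 * E₀)| ≤ σ * |Ep + Em - 2 * E₀| := by
    rw [abs_mul]; exact mul_le_mul_of_nonneg_right hs (abs_nonneg _)
  obtain ⟨hA1, hA2⟩ := abs_le.mp hA
  have hs2 : s ^ 2 ≤ σ ^ 2 := by
    rw [← sq_abs s]; exact pow_le_pow_left₀ (abs_nonneg s) hs 2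
  have hs0 : 0 ≤ s ^ 2 := sq_nonneg s
  rw [abs_le]
  constructor <;> linarith

/-- Sign: the read `t²` is nonnegative when the shifted nonbonding sheet `E₀ + 2s` lies between the
even sheets (for `s = 0`: when the nonbonding sheet is the middle one). [folklore] -/
theorem readTperpSq_nonneg {Em E₀ Ep s : ℝ} (h1 : Em ≤ E₀ + 2 * s) (h2 : E₀ + 2 * s ≤ Ep) :
    0 ≤ readTperpSq Em E₀ Ep s := by
  rw [readTperpSq_def]
  exact div_nonneg (mul_nonneg (by linarith) (by linarith)) (by norm_num)

/-- Conversely a nonbonding sheet OUTSIDE the even pair reads a negative `t²` — an inconsistent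
labelling is detected, not absorbed. [folklore] -/
theorem readTperpSq_neg_of_lt {Em E₀ Ep s : ℝ} (hle : Em ≤ Ep) (h : Ep < E₀ + 2 * s) :
    readTperpSq Em E₀ Ep s < 0 := by
  rw [readTperpSq_def]
  have : (Ep - E₀ - 2 * s) * (E₀ + 2 * s - Em) < 0 := mul_neg_of_neg_of_pos (by linarith) (by linarith)
  linarith

/-- **Ceiling**: `readTperpSq ≤ (E₊ − E₋)²/8` for every position of the nonbonding sheet and every `s`
(AM–GM) — three sheets never certify `|t⊥| > (E₊ − E₋)/(2√2)`; this is the splitting floor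
`D ≥ 2√2·|t|` of `TrilayerEvenSectorClosedForm.evenSplitting_ge` read backwards. [folklore] -/
theorem readTperpSq_le (Em E₀ Ep s : ℝ) : readTperpSq Em E₀ Ep s ≤ (Ep - Em) ^ 2 / 8 := by
  rw [readTperpSq_def]
  nlinarith [sq_nonneg (Ep + Em - 2 * E₀ - 4 * s)]

/-- The ceiling is attained exactly when `E₀ + 2s` is the midpoint of the even pair (`δ_read = 0`, the
degenerate case of `TrilayerSplittingIdentities`). [folklore] -/
theorem readTperpSq_midpoint (Em Ep s : ℝ) :
    readTperpSq Em ((Ep + Em) / 2 - 2 * s) Ep s = (Ep - Em) ^ 2 / 8 := by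
  rw [readTperpSq_def]; ring

/-- Monotonicity of the `s = 0` reading in the nonbonding position below the midpoint: moving `E₀` up
towards `(E₊ + E₋)/2` increases the read `t²` (derivative `E₊ + E₋ − 2E₀ ≥ 0`). [folklore] -/
theorem readTperpSq_mono_below {Em Ep E₀ E₀' : ℝ} (h : E₀ ≤ E₀') (hmid : E₀' ≤ (Ep + Em) / 2) :
    readTperpSq Em E₀ Ep 0 ≤ readTperpSq Em E₀' Ep 0 := by
  rw [readTperpSq_def, readTperpSq_def]
  nlinarith [mul_nonneg (sub_nonneg.mpr h) (by linarith : (0:ℝ) ≤ Ep + Em - E₀ - E₀')]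

/-! ## §5 A rational instance -/

/-- Instance `εo = s = 0`, `εi = t = 1`: `D = 3`, even sheets `2` and `−1`, nonbonding sheet `0` in the
middle. [cite: LuoEtAl2023, Eq. (3)] -/
theorem instance_levels : levelP 0 1 1 0 = 2 ∧ levelM 0 1 1 0 = -1 := by
  have h : disc (offset 0 1 0) 1 = 3 := by
    rw [disc_def, offset_def, show ((1:ℝ) - (0 + 0)) ^ 2 + 8 * 1 ^ 2 = 3 ^ 2 by norm_num]
    exact sqrt_sq (by norm_num)
  rw [levelP_def, levelM_def, h]
  norm_num

/-- … and the sheets `(−1, 0, 2)` read back `εo = 0`, `εi = 1`, `t² = 1`, `δ = 1`; with an undeclared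
`s = 1/4` the same sheets would read `εo = 1/4`, `εi = 1/2`, `t² = 9/8`. [folklore] -/
theorem instance_read :
    readOuter 0 0 = 0 ∧ readInner (-1) 0 2 0 = 1 ∧ readTperpSq (-1) 0 2 0 = 1 ∧
      readOffset (-1) 0 2 0 = 1 ∧
    readOuter 0 (1/4) = 1/4 ∧ readInner (-1) 0 2 (1/4) = 1/2 ∧ readTperpSq (-1) 0 2 (1/4) = 9/8 := by
  simp only [readOuter_def, readInner_def, readTperpSq_def, readOffset_def]
  norm_num

end Summit.Ventures.CertifiedManyBodySolver.Downfold.TrilayerReading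

end
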